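import Summits.QuantumFields.YangMills.Theorems.SmallFieldWideningWideningOfTiltAndMass
import Summits.QuantumFields.YangMills.Theorems.SmallFieldWideningLargeFieldMassRefinementTailProfileMono
import Literature.MathematicalPhysics.QuantumFieldTheory.Balaban1983to89.T3InteriorExcision

/-!
# Route `SmallFieldWidening` — THE WIDENING AS A BY-NAME PATTERN (support file for item `WideningOfTiltAndMass`,
# stmt-QuantumFields-22885; seat `ym-line-sfw-p1` gen 6)

The item (PROVED, `smallFieldWidening_wideningOfTiltAndMass_proof`, gen 0) is stated for ONE window family — Bałaban's
all-heights UV-small-history events `histGood … K 0` at the profile `θBal` — and for the printed smearing `ℰp` on `SU(2)`.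
Its proof uses neither: it is the Moore–Osgood device «for every `ε` some shifted tail of the expectation sequence is
uniformly `ε`-close to a Cauchy sequence» fed by ONE CHAINED family of tilt-related good parts with a `K`-UNIFORM bad mass.
This file exports that device BY NAME, in the generality the route's partner items may need when they are re-typed:

§1 `exists_cauchySeq_near_integral_from` — the abstract near-Cauchy lemma of the landed file with finitely many EXCISED
   initial steps (chain and mass bound only for `K ≥ K₀`; the conclusion is about the `K₀`-shifted sequence).
§2 `exists_cauchySeq_near_integral_unitLaw` — ONE family, EVERY gauge group `G`, EVERY measurable smearing `ℰ`, ANY measurable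
   windows `E_K` of the runs: chained unit tilts of summable radii from `K₀` on + Gibbs masses of `E_Kᶜ` bounded by `δ < 1`
   from `K₀` on ⇒ every unit-law expectation sequence of a measurable `|W| ≤ 1` is within `2δ` of a Cauchy sequence
   (oscillation `≤ 4δ`): the `K`-uniform twin of the tree's `abs_integral_unitLaw_succ_sub_le`.
§3 `hasContinuumLimit_of_refine_unitTilt_uniformMass` (`∀ ε ∃ depth` form) and `…_tendsto` (`n ≥ n₀`, `δ n → 0` form) — THE
   PATTERN the item's informal text names («`hasContinuumLimit_of_refine_unitTiltTail` with the summable `w` replaced by the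
   `K`-uniform `δ n`»), for every `G`, `ℰ`, window family and excision depth; `continuumYM3Torus_of_refine_unitTilt_uniformMass`
   its `SU(N)` reading through `continuumYM3Torus_iff_hasContinuumLimit_SU`.
§4 On `SU(2)`/`ℰp`: `hasContinuumLimit_of_refine_windowTilt_allHeightsMass` — chained tilts on ANY measurable windows CONTAINING
   the all-heights window (from some `K₀(n)` on) + the r3-shape all-heights mass `δ n → 0` ⇒ `HasContinuumLimit`; the item
   (proof of record `smallFieldWidening_wideningOfTiltAndMass_proof`) is the instance `E_K = histGood … K 0`, `K₀ = 0`.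
§5 Leaf level: `ym3TorusSU2_of_windowTilt` — «r2 delivered on ANY chained window family containing the all-heights window, for
   profiles beyond thresholds, finitely many initial steps excised» + r3 `LargeFieldMassRefinementTail` AS FILED ⇒ the rung-R3
   leaf `YM3TorusSU2` (r3's profile pushed past the thresholds by `largeFieldMassRefinementTail_beyond`); and the INTERIOR
   instance `ym3TorusSU2_of_interiorTilt` — the `m = 0` analogue of route `UnitScaleTilt`'s interior text 19935ᴵ/20520
   (`T3InteriorExcision.histGoodInt … K 0`: all heights in the window AND the unit field in the deep interior `θBal(c·b₀) 0`,
   `0 < c ≤ 1`, steps `K < K₀` excised): the edge band is charged to r3 at the profile `c·b₀`, which r3's existential profile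
   absorbs (`b₀ := b⋆/c`).

WHY (planner-of-record ym-idea-1, 2026-08-28T00:45Z): a re-typing of r2 ALONE (thresholded / interior / excised, the shapes
route `UnitScaleTilt`'s deciding items deliver) «would break the proved chain s9 → closes».  After this file it does not: the
assembly closes by name from any such r2 and the filed r3.  WHAT THIS IS NOT: no estimate, no crux (r2, r3 stay OPEN), no
d = 4, no mass gap, no Clay — rung-R3 record plumbing only; every declaration is measure theory over tree objects.
-/

noncomputable section

open MeasureTheory Filter Topology
open scoped ENNReal
open Literature.MathematicalPhysics.QuantumFieldTheory.Balaban1983to89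
open Literature.MathematicalPhysics.QuantumFieldTheory.Balaban1983to89.Missing
open Literature.MathematicalPhysics.QuantumFieldTheory.Balaban1983to89.T3ContinuumYM3Torus
open Literature.MathematicalPhysics.QuantumFieldTheory.Balaban1983to89.T3ThresholdRemoval
open Literature.MathematicalPhysics.QuantumFieldTheory.Balaban1983to89.T3UnitLawDensityEML (ℰp measurableE_ℰp)
open Literature.MathematicalPhysics.QuantumFieldTheory.Balaban1983to89.T3UnitScaleTilt
open Literature.MathematicalPhysics.QuantumFieldTheory.Balaban1983to89.T3InteriorExcision
  (histGoodInt measurableSet_histGoodInt histGood_subset_histGoodInt histGood_mono_profile)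
open Summit.QuantumFields.YangMills.Theorems.LargeFieldMassRefinementTailProfileMono
  (θBal_mono_profile largeFieldMassRefinementTail_beyond)

namespace Summit.QuantumFields.YangMills.Theorems.WideningOfTiltAndMass

/-! ## §1 The abstract near-Cauchy lemma with excised initial steps -/

section Abstract

variable {X : Type*} [MeasurableSpace X]

/-- **APPROXIMATELY CAUCHY EXPECTATIONS, FINITELY MANY STEPS EXCISED**: probability laws `P_K`, split as `μ_K + μ'_K` for
`K ≥ K₀` with bad masses `μ'_K(univ) ≤ δ < 1` and consecutive good parts tilt-related with radii `r_K`, `Σ r_K < ∞`, for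
`K ≥ K₀`.  Then for every measurable `|W| ≤ 1` the SHIFTED expectation sequence `K ↦ ∫ W dP_{K+K₀}` is within `2δ` of a Cauchy
sequence (the landed `exists_cauchySeq_near_integral` applied to the shifted data). [folklore] -/
theorem exists_cauchySeq_near_integral_from (P μ μ' : ℕ → Measure X) (K₀ : ℕ)
    (hPp : ∀ K, IsProbabilityMeasure (P K)) (hP : ∀ K, K₀ ≤ K → P K = μ K + μ' K) {δ : ℝ}
    (hδ : ∀ K, K₀ ≤ K → (μ' K).real Set.univ ≤ δ) (hδ1 : δ < 1) {r : ℕ → ℝ} (hr : Summable r)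
    (ht : ∀ K, K₀ ≤ K → IsTilt (μ K) (μ (K + 1)) (r K)) {W : X → ℝ} (hWm : Measurable W)
    (hW : ∀ x, |W x| ≤ 1) :
    ∃ b : ℕ → ℝ, CauchySeq b ∧ ∀ K, |(∫ x, W x ∂P (K + K₀)) - b K| ≤ 2 * δ :=
  exists_cauchySeq_near_integral (fun K => P (K + K₀)) (fun K => μ (K + K₀)) (fun K => μ' (K + K₀))
    (fun K => hPp (K + K₀)) (fun K => hP (K + K₀) (Nat.le_add_left K₀ K))
    (fun K => hδ (K + K₀) (Nat.le_add_left K₀ K)) hδ1 ((summable_nat_add_iff K₀).mpr hr)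
    (fun K => by
      have e : K + 1 + K₀ = K + K₀ + 1 := Nat.add_right_comm K 1 K₀
      rw [e]
      exact ht (K + K₀) (Nat.le_add_left K₀ K))
    hWm hW

end Abstract

/-! ## §2 One family, every `G`, every measurable `ℰ`, any windows: `K`-uniform near-Cauchy at the unit lattice -/

section OneFamily

variable (F : T3Family) {G : Type*} [GaugeGroup G] [MeasurableSpace G] [HaarData G] [RegularGaugeGroup G]
  (ℰ : LoopAverage G)

/-- **THE `K`-UNIFORM TWIN OF KING'S CAUCHY DEVICE AT THE UNIT LATTICE** (every gauge group, every measurable smearing, any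
measurable windows `E_K` of the runs' fine fields, `γ ≥ 0`): if from step `K₀` on the unit push-forwards
(`unitA`, `A_K = unitShift ∘ avg^K`) of the Gibbs measures restricted to `E_K`, `E_{K+1}` are CHAINED tilts of summable radii and
the Gibbs masses of `E_Kᶜ` are `≤ δ < 1`, then for every measurable unit-field observable `|W| ≤ 1` the shifted unit-law
expectations `K ↦ ∫ W d(unitLaw (K+K₀))` are within `2δ` of a Cauchy sequence — in particular their oscillation is `≤ 4δ`
([King1986] (3.9)–(3.13) with the summable bad masses replaced by ONE `K`-uniform mass; the chain — ONE window per run — is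
what makes the uniform mass usable only twice instead of once per step). [cite: King1986, Thm 3.4 (3.9)-(3.13) p.656] -/
theorem exists_cauchySeq_near_integral_unitLaw (hE : ℰ.MeasurableE) {γ : ℝ} (hγ : 0 ≤ γ) (K₀ : ℕ)
    (E : ∀ K, Set (GaugeField (F.P K) 0 G)) (hEm : ∀ K, MeasurableSet (E K)) {δ : ℝ} (hδ1 : δ < 1)
    (hmass : ∀ K, K₀ ≤ K → (gibbsK F ℰ γ K).real (E K)ᶜ ≤ δ) {r : ℕ → ℝ} (hr : Summable r)
    (ht : ∀ K, K₀ ≤ K → IsTilt (Measure.map (unitA F ℰ K) ((gibbsK F ℰ γ K).restrict (E K)))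
      (Measure.map (unitA F ℰ (K + 1)) ((gibbsK F ℰ γ (K + 1)).restrict (E (K + 1)))) (r K))
    {W : GaugeField (F.P 0) 0 G → ℝ} (hWm : Measurable W) (hW : ∀ u, |W u| ≤ 1) :
    ∃ b : ℕ → ℝ, CauchySeq b ∧ ∀ K, |(∫ u, W u ∂F.unitLaw ℰ hE γ (K + K₀)) - b K| ≤ 2 * δ :=
  exists_cauchySeq_near_integral_from (fun K => F.unitLaw ℰ hE γ K)
    (fun K => Measure.map (unitA F ℰ K) ((gibbsK F ℰ γ K).restrict (E K)))
    (fun K => Measure.map (unitA F ℰ K) ((gibbsK F ℰ γ K).restrict (E K)ᶜ)) K₀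
    (fun K => isProbabilityMeasure_unitLaw hE hγ K) (fun K _ => unitLaw_eq_map_restrict_add hE K (hEm K))
    (fun K hK => by rw [real_map_restrict_univ hE]; exact hmass K hK) hδ1 hr ht hWm hW

end OneFamily

/-! ## §3 THE PATTERN: chained unit tilts + a `K`-uniform mass vanishing along refinement ⇒ the continuum limit -/

section Pattern

variable (F : T3Family) {G : Type*} [GaugeGroup G] [MeasurableSpace G] [HaarData G] [RegularGaugeGroup G]
  (ℰ : LoopAverage G)

/-- **THE WIDENING PATTERN, `∀ ε ∃ depth` FORM** (every `G`, every measurable `ℰ`, `γ ≥ 0`): if for every `ε > 0` there are a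
refinement depth `n`, an excision depth `K₀`, a mass `δ ≤ ε`, `δ < 1`, measurable windows `E_K` of the refined family
`F.refine n` at coupling `γL^{-n}` and summable radii `r_K` such that from `K₀` on the unit push-forwards of the restricted
Gibbs measures are chained tilts of radii `r_K` and the Gibbs masses of `E_Kᶜ` are `≤ δ`, then the ORIGINAL family's joint
expectations converge along the full sequence: `HasContinuumLimit (F.scheme ℰ γ)`.  (Its terms from index `K₀ + n` on are the
integrals of the bounded measurable `coarseObs` against the refined unit laws, `expectAt_refine`; §2 puts them within `2δ ≤ 2ε`
of a Cauchy sequence; the landed `cauchySeq_of_forall_near_cauchySeq` concludes.)  The route item `WideningOfTiltAndMass` is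
the instance `G = SU(2)`, `ℰ = ℰp`, `E_K = histGood … K 0`, `K₀ = 0`, `n ≥ n₀` with `δ n → 0`. [cite: King1986, Thm 3.4 (3.9)-(3.13) p.656] -/
theorem hasContinuumLimit_of_refine_unitTilt_uniformMass (hE : ℰ.MeasurableE) {γ : ℝ} (hγ : 0 ≤ γ)
    (h : ∀ ε : ℝ, 0 < ε → ∃ (n K₀ : ℕ) (δ : ℝ) (E : ∀ K, Set (GaugeField ((F.refine n).P K) 0 G)) (r : ℕ → ℝ),
      δ ≤ ε ∧ δ < 1 ∧ (∀ K, MeasurableSet (E K)) ∧ Summable r ∧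
      (∀ K, K₀ ≤ K → IsTilt
        (Measure.map (unitA (F.refine n) ℰ K)
          ((gibbsK (F.refine n) ℰ (γ * ((F.L : ℝ)⁻¹) ^ n) K).restrict (E K)))
        (Measure.map (unitA (F.refine n) ℰ (K + 1))
          ((gibbsK (F.refine n) ℰ (γ * ((F.L : ℝ)⁻¹) ^ n) (K + 1)).restrict (E (K + 1)))) (r K)) ∧
      (∀ K, K₀ ≤ K → (gibbsK (F.refine n) ℰ (γ * ((F.L : ℝ)⁻¹) ^ n) K).real (E K)ᶜ ≤ δ)) :
    HasContinuumLimit (F.scheme ℰ γ) := by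
  intro Cs
  suffices hcs : CauchySeq fun K => (F.scheme ℰ γ).expectAt K Cs from cauchySeq_tendsto_of_complete hcs
  refine cauchySeq_of_forall_near_cauchySeq fun ε hε => ?_
  obtain ⟨n, K₀, δ, E, r, hδε, hδ1, hEm, hr, ht, hmass⟩ := h (ε / 2) (half_pos hε)
  have hγ' : 0 ≤ γ * ((F.L : ℝ)⁻¹) ^ n := mul_nonneg hγ (pow_nonneg (inv_nonneg.mpr (Nat.cast_nonneg _)) n)
  obtain ⟨b, hb, hnear⟩ := exists_cauchySeq_near_integral_unitLaw (F.refine n) ℰ hE hγ' K₀ E hEm hδ1 hmass hr ht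
    (measurable_coarseObs F n ℰ hE Cs) (abs_coarseObs_le_one F n ℰ Cs)
  refine ⟨K₀ + n, b, hb, fun K => ?_⟩
  show |(F.scheme ℰ γ).expectAt (K + (K₀ + n)) Cs - b K| ≤ ε
  rw [← Nat.add_assoc, expectAt_refine F n ℰ hE hγ (K + K₀) Cs]
  exact (hnear K).trans (by linarith)

/-- **THE WIDENING PATTERN, `δ n → 0` FORM** (the item's quantifier shape; every `G`, every measurable `ℰ`, `γ ≥ 0`): chained unit
tilts on measurable windows with summable radii from some `K₀(n)` on, at every refinement depth `n ≥ n₀`, with the Gibbs masses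
of the windows' complements `≤ δ n` from `K₀(n)` on and `δ n → 0` ⇒ `HasContinuumLimit (F.scheme ℰ γ)`. [cite: King1986, Thm 3.4 (3.9)-(3.13) p.656] -/
theorem hasContinuumLimit_of_refine_unitTilt_uniformMass_tendsto (hE : ℰ.MeasurableE) {γ : ℝ} (hγ : 0 ≤ γ) (n₀ : ℕ)
    {δ : ℕ → ℝ} (hδ : Tendsto δ atTop (𝓝 0))
    (h : ∀ n : ℕ, n₀ ≤ n → ∃ (K₀ : ℕ) (E : ∀ K, Set (GaugeField ((F.refine n).P K) 0 G)) (r : ℕ → ℝ),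
      (∀ K, MeasurableSet (E K)) ∧ Summable r ∧
      (∀ K, K₀ ≤ K → IsTilt
        (Measure.map (unitA (F.refine n) ℰ K)
          ((gibbsK (F.refine n) ℰ (γ * ((F.L : ℝ)⁻¹) ^ n) K).restrict (E K)))
        (Measure.map (unitA (F.refine n) ℰ (K + 1))
          ((gibbsK (F.refine n) ℰ (γ * ((F.L : ℝ)⁻¹) ^ n) (K + 1)).restrict (E (K + 1)))) (r K)) ∧
      (∀ K, K₀ ≤ K → (gibbsK (F.refine n) ℰ (γ * ((F.L : ℝ)⁻¹) ^ n) K).real (E K)ᶜ ≤ δ n)) :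
    HasContinuumLimit (F.scheme ℰ γ) := by
  refine hasContinuumLimit_of_refine_unitTilt_uniformMass F ℰ hE hγ fun ε hε => ?_
  obtain ⟨n, hn₀, hn⟩ : ∃ n, n₀ ≤ n ∧ δ n < min ε 1 := by
    obtain ⟨n, hn⟩ := ((hδ.eventually (gt_mem_nhds (lt_min hε one_pos))).and (eventually_ge_atTop n₀)).exists
    exact ⟨n, hn.2, hn.1⟩
  obtain ⟨K₀, E, r, hEm, hr, ht, hmass⟩ := h n hn₀
  exact ⟨n, K₀, δ n, E, r, (hn.trans_le (min_le_left _ _)).le, hn.trans_le (min_le_right _ _), hEm, hr, ht, hmass⟩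

end Pattern

section PatternSU

variable {N : ℕ} [NeZero N] (F : T3Family) (ℰ : LoopAverage (Matrix.specialUnitaryGroup (Fin N) ℂ))

/-- **ON `SU(N)`: THE PATTERN GIVES ALL FOUR CONJUNCTS** of `ContinuumYM3Torus F ℰ γ` (existence, uniqueness in `(L, m)`,
reflection positivity, torus covariance — the last three are tree theorems, `continuumYM3Torus_iff_hasContinuumLimit_SU`), for
every measurable `ℰ` and `γ ≥ 0`. [cite: JaffeWittenClay2006, §6.5 p.11] -/
theorem continuumYM3Torus_of_refine_unitTilt_uniformMass (hE : ℰ.MeasurableE) {γ : ℝ} (hγ : 0 ≤ γ) (n₀ : ℕ)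
    {δ : ℕ → ℝ} (hδ : Tendsto δ atTop (𝓝 0))
    (h : ∀ n : ℕ, n₀ ≤ n → ∃ (K₀ : ℕ)
      (E : ∀ K, Set (GaugeField ((F.refine n).P K) 0 (Matrix.specialUnitaryGroup (Fin N) ℂ))) (r : ℕ → ℝ),
      (∀ K, MeasurableSet (E K)) ∧ Summable r ∧
      (∀ K, K₀ ≤ K → IsTilt
        (Measure.map (unitA (F.refine n) ℰ K)
          ((gibbsK (F.refine n) ℰ (γ * ((F.L : ℝ)⁻¹) ^ n) K).restrict (E K)))
        (Measure.map (unitA (F.refine n) ℰ (K + 1))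
          ((gibbsK (F.refine n) ℰ (γ * ((F.L : ℝ)⁻¹) ^ n) (K + 1)).restrict (E (K + 1)))) (r K)) ∧
      (∀ K, K₀ ≤ K → (gibbsK (F.refine n) ℰ (γ * ((F.L : ℝ)⁻¹) ^ n) K).real (E K)ᶜ ≤ δ n)) :
    ContinuumYM3Torus F ℰ γ :=
  (continuumYM3Torus_iff_hasContinuumLimit_SU F ℰ hE hγ).mpr
    (hasContinuumLimit_of_refine_unitTilt_uniformMass_tendsto F ℰ hE hγ n₀ hδ h)

end PatternSU

/-! ## §4 On `SU(2)`/`ℰp`: windows containing the all-heights window + the r3-shape mass -/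

section Windows

/-- Refinement depth below a positive threshold, uniformly onwards (`γ > 0`, `1 < L`): `∃ n₀, ∀ n ≥ n₀, γL^{-n} ≤ s`. [folklore] -/
theorem exists_depth_le (F : T3Family) {γ s : ℝ} (hγ : 0 < γ) (hs : 0 < s) :
    ∃ n₀ : ℕ, ∀ n : ℕ, n₀ ≤ n → γ * ((F.L : ℝ)⁻¹) ^ n ≤ s := by
  have hL : (1 : ℝ) < F.L := by exact_mod_cast F.hL.2
  have hL0 : (0 : ℝ) < F.L := zero_lt_one.trans hL
  have hq0 : 0 ≤ ((F.L : ℝ))⁻¹ := inv_nonneg.mpr hL0.le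
  have hq1 : ((F.L : ℝ))⁻¹ ≤ 1 := inv_le_one_of_one_le₀ hL.le
  obtain ⟨n₀, hn₀⟩ := ((tendsto_pow_atTop_nhds_zero_of_lt_one hq0
    (inv_lt_one_of_one_lt₀ hL)).eventually (ge_mem_nhds (div_pos hs hγ))).exists
  refine ⟨n₀, fun n hn => ?_⟩
  calc γ * ((F.L : ℝ)⁻¹) ^ n ≤ γ * ((F.L : ℝ)⁻¹) ^ n₀ :=
        mul_le_mul_of_nonneg_left (pow_le_pow_of_le_one hq0 hq1 hn) hγ.le
    _ ≤ γ * (s / γ) := mul_le_mul_of_nonneg_left hn₀ hγ.le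
    _ = s := mul_div_cancel₀ _ hγ.ne'

/-- The refined couplings are positive (`γ > 0`). [folklore] -/
theorem refine_coupling_pos (F : T3Family) {γ : ℝ} (hγ : 0 < γ) (n : ℕ) : 0 < γ * ((F.L : ℝ)⁻¹) ^ n :=
  mul_pos hγ (pow_pos (inv_pos.mpr (by
    have hL : (1 : ℝ) < F.L := by exact_mod_cast F.hL.2
    exact zero_lt_one.trans hL)) n)

/-- **THE WIDENING FOR WINDOWS CONTAINING THE ALL-HEIGHTS WINDOW** (`SU(2)`, printed smearing `ℰp`, `γ > 0`): if at every
refinement depth `n ≥ n₀` the refined family `F.refine n` at `γL^{-n}` carries, from some step `K₀(n)` on, measurable windows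
`E_K ⊇ histGood … K 0` (the all-heights UV-small-history event at the profile `(b₀, p₀)`) whose restricted unit push-forwards are
CHAINED tilts of summable radii, and ONE sequence `δ n → 0` bounds the Gibbs masses of the all-heights complements of all its
runs (crux r3's body), then `HasContinuumLimit (F.scheme ℰp γ)` — the complements `E_Kᶜ ⊆ (histGood … K 0)ᶜ` inherit the mass
bound.  The item `WideningOfTiltAndMass` is the case `E_K = histGood … K 0`, `K₀ = 0` (`UnitTiltAt … 0`, `K / 0 = 0`). [cite: King1986, Thm 3.4 (3.9)-(3.13) p.656] -/
theorem hasContinuumLimit_of_refine_windowTilt_allHeightsMass (F : T3Family) {γ b₀ p₀ : ℝ} (n₀ : ℕ) (hγ : 0 < γ)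
    (hT : ∀ n : ℕ, n₀ ≤ n → ∃ (K₀ : ℕ)
      (E : ∀ K, Set (GaugeField ((F.refine n).P K) 0 (Matrix.specialUnitaryGroup (Fin 2) ℂ))) (r : ℕ → ℝ),
      (∀ K, MeasurableSet (E K)) ∧ Summable r ∧
      (∀ K, K₀ ≤ K →
        histGood (F.refine n) ℰp (θBal (F.refine n).L (γ * ((F.L : ℝ)⁻¹) ^ n) b₀ p₀) K 0 ⊆ E K) ∧
      (∀ K, K₀ ≤ K → IsTilt
        (Measure.map (unitA (F.refine n) ℰp K)
          ((gibbsK (F.refine n) ℰp (γ * ((F.L : ℝ)⁻¹) ^ n) K).restrict (E K)))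
        (Measure.map (unitA (F.refine n) ℰp (K + 1))
          ((gibbsK (F.refine n) ℰp (γ * ((F.L : ℝ)⁻¹) ^ n) (K + 1)).restrict (E (K + 1)))) (r K)))
    (hM : ∃ δ : ℕ → ℝ, Tendsto δ atTop (𝓝 0) ∧ ∀ n K : ℕ, n₀ ≤ n →
      (gibbsK (F.refine n) ℰp (γ * ((F.L : ℝ)⁻¹) ^ n) K).real
        (histGood (F.refine n) ℰp (θBal (F.refine n).L (γ * ((F.L : ℝ)⁻¹) ^ n) b₀ p₀) K 0)ᶜ ≤ δ n) :
    HasContinuumLimit (F.scheme ℰp γ) := by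
  obtain ⟨δ, hδ, hmass⟩ := hM
  refine hasContinuumLimit_of_refine_unitTilt_uniformMass_tendsto F ℰp measurableE_ℰp hγ.le n₀ hδ fun n hn => ?_
  obtain ⟨K₀, E, r, hEm, hr, hsub, ht⟩ := hT n hn
  refine ⟨K₀, E, r, hEm, hr, ht, fun K hK => ?_⟩
  haveI := isProbabilityMeasure_gibbsK (F.refine n) ℰp (refine_coupling_pos F hγ n).le K
  exact (measureReal_mono (Set.compl_subset_compl.mpr (hsub K hK)) (measure_ne_top _ _)).trans (hmass n K hn)

end Windows

/-! ## §5 Leaf level: the assembly is robust to window / threshold / excision re-typings of r2 -/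

section Leaf

/-- **THE RUNG-R3 LEAF FROM r3 AS FILED AND r2 ON ANY CHAINED WINDOW FAMILY CONTAINING THE ALL-HEIGHTS WINDOW** (profiles beyond
thresholds `(b₁(L), p₁(L))` — route `UnitScaleTilt`'s quantifier shape —, finitely many initial steps excised per family): r3's
existential profile is pushed beyond the thresholds (`largeFieldMassRefinementTail_beyond`), the depth `n₀` is chosen with
`γL^{-n} ≤ min γ₁ γ₂`, and §4 concludes `HasContinuumLimit`; the leaf's other conjuncts are tree theorems
(`continuumYM3Torus_iff_hasContinuumLimit_SU`).  CONDITIONAL on both hypotheses (open); no summit, no mass gap. [cite: King1986, Thm 3.4 (3.9)-(3.13) p.656] -/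
theorem ym3TorusSU2_of_windowTilt
    (hT : ∀ (L : ℕ), ∃ b₁ p₁ : ℝ, ∀ (b₀ p₀ : ℝ), b₁ ≤ b₀ → p₁ ≤ p₀ → 0 < b₀ → 2 < p₀ →
      ∃ γ₂ : ℝ, 0 < γ₂ ∧ ∀ (F : T3Family) (γ : ℝ), F.L = L → 0 < γ → γ ≤ γ₂ →
        ∃ (K₀ : ℕ) (E : ∀ K, Set (GaugeField (F.P K) 0 (Matrix.specialUnitaryGroup (Fin 2) ℂ))) (r : ℕ → ℝ),
          (∀ K, MeasurableSet (E K)) ∧ Summable r ∧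
          (∀ K, K₀ ≤ K → histGood F ℰp (θBal F.L γ b₀ p₀) K 0 ⊆ E K) ∧
          (∀ K, K₀ ≤ K → IsTilt
            (Measure.map (unitA F ℰp K) ((gibbsK F ℰp γ K).restrict (E K)))
            (Measure.map (unitA F ℰp (K + 1)) ((gibbsK F ℰp γ (K + 1)).restrict (E (K + 1)))) (r K)))
    (hM : Summit.QuantumFields.YangMills.Theses.SmallFieldWidening.LargeFieldMassRefinementTail) :
    Literature.MathematicalPhysics.QuantumFieldTheory.Balaban1983to89.T3YM3TorusStatement.YM3TorusSU2 := by
  refine ⟨1, one_pos, fun F γ hγ _ => ?_⟩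
  obtain ⟨b₁, p₁, hT'⟩ := hT F.L
  obtain ⟨b₀, p₀, γ₁, hb₁, hp₁, hb₀, hp₀, hγ₁, -, hM'⟩ := largeFieldMassRefinementTail_beyond hM F.L b₁ p₁
  obtain ⟨γ₂, hγ₂, hT''⟩ := hT' b₀ p₀ hb₁ hp₁ hb₀ hp₀
  obtain ⟨δ, hδ, hmass⟩ := hM' F γ rfl hγ
  obtain ⟨n₀, hle⟩ := exists_depth_le F hγ (lt_min hγ₁ hγ₂)
  have hlim : HasContinuumLimit (F.scheme ℰp γ) :=
    hasContinuumLimit_of_refine_windowTilt_allHeightsMass F n₀ hγ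
      (fun n hn => hT'' (F.refine n) _ rfl (refine_coupling_pos F hγ n) ((hle n hn).trans (min_le_right _ _)))
      ⟨δ, hδ, fun n K hn => hmass n K ((hle n hn).trans (min_le_left _ _))⟩
  exact (continuumYM3Torus_iff_hasContinuumLimit_SU F ℰp measurableE_ℰp hγ.le).mpr hlim

/-- **THE INTERIOR INSTANCE — r2 IN ROUTE `UnitScaleTilt`'S INTERIOR-EXCISION SHAPE AT `m = 0`** (the all-heights analogue of the
deciding item 19935ᴵ/stmt-QuantumFields-20520: one interior ratio `0 < c ≤ 1` and thresholds `(b₁, p₁)` per block size; for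
profiles beyond them and `γ ≤ γ₂` the unit push-forwards of the Gibbs measures restricted to the INTERIOR all-heights events
`histGoodInt … K 0` — every height in Bałaban's window at `(b₀, p₀)` AND the unit field in the deep interior `θBal(c·b₀) 0` — are
chained tilts of summable radii from some step `K₀` on) **+ r3 AS FILED ⇒ THE LEAF.**  The edge band
`{unit field θBal(c·b₀)-large} ∩ histGood(b₀)` is charged to r3 at the profile `c·b₀`: r3's profile `b⋆` is pushed beyond `b₁`
(`largeFieldMassRefinementTail_beyond`, `γ₁ ≤ 1`) and r2 is invoked at `b₀ := b⋆/c ≥ b⋆`, so that `histGood(b⋆) ⊆ histGoodInt(b₀;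
θBal(c·b₀) 0 = θBal(b⋆) 0)` (`histGood_subset_histGoodInt`, `θBal_mono_profile` on couplings `≤ 1`).  CONDITIONAL on both
hypotheses (open); no summit, no mass gap. [cite: King1986, Prop. 3.8-3.9 pp.664-665] -/
theorem ym3TorusSU2_of_interiorTilt
    (hT : ∀ (L : ℕ), ∃ c b₁ p₁ : ℝ, 0 < c ∧ c ≤ 1 ∧ ∀ (b₀ p₀ : ℝ), b₁ ≤ b₀ → p₁ ≤ p₀ → 0 < b₀ → 2 < p₀ →
      ∃ γ₂ : ℝ, 0 < γ₂ ∧ ∀ (F : T3Family) (γ : ℝ), F.L = L → 0 < γ → γ ≤ γ₂ →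
        ∃ (K₀ : ℕ) (r : ℕ → ℝ), Summable r ∧ ∀ K, K₀ ≤ K → IsTilt
          (Measure.map (unitA F ℰp K) ((gibbsK F ℰp γ K).restrict
            (histGoodInt F (θBal F.L γ b₀ p₀) (θBal F.L γ (c * b₀) p₀ 0) K 0)))
          (Measure.map (unitA F ℰp (K + 1)) ((gibbsK F ℰp γ (K + 1)).restrict
            (histGoodInt F (θBal F.L γ b₀ p₀) (θBal F.L γ (c * b₀) p₀ 0) (K + 1) 0))) (r K))
    (hM : Summit.QuantumFields.YangMills.Theses.SmallFieldWidening.LargeFieldMassRefinementTail) :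
    Literature.MathematicalPhysics.QuantumFieldTheory.Balaban1983to89.T3YM3TorusStatement.YM3TorusSU2 := by
  refine ⟨1, one_pos, fun F γ hγ _ => ?_⟩
  obtain ⟨c, b₁, p₁, hc, hc1, hT'⟩ := hT F.L
  obtain ⟨bs, p₀, γ₁, hb₁, hp₁, hbs, hp₀, hγ₁, hγ₁1, hM'⟩ := largeFieldMassRefinementTail_beyond hM F.L b₁ p₁
  -- r2 at the profile `b₀ := b⋆ / c ≥ b⋆ ≥ b₁`, whose interior window `c·b₀ = b⋆` is r3's
  have hbs0 : bs ≤ bs / c := by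
    rw [le_div_iff₀ hc]
    exact mul_le_of_le_one_right hbs.le hc1
  have hcb : c * (bs / c) = bs := mul_div_cancel₀ bs hc.ne'
  obtain ⟨γ₂, hγ₂, hT''⟩ := hT' (bs / c) p₀ (hb₁.trans hbs0) hp₁ (hbs.trans_le hbs0) hp₀
  obtain ⟨δ, hδ, hmass⟩ := hM' F γ rfl hγ
  obtain ⟨n₀, hle⟩ := exists_depth_le F hγ (lt_min hγ₁ hγ₂)
  have hlim : HasContinuumLimit (F.scheme ℰp γ) := by
    refine hasContinuumLimit_of_refine_windowTilt_allHeightsMass F (b₀ := bs) (p₀ := p₀) n₀ hγ (fun n hn => ?_)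
      ⟨δ, hδ, fun n K hn => hmass n K ((hle n hn).trans (min_le_left _ _))⟩
    obtain ⟨K₀, r, hr, ht⟩ :=
      hT'' (F.refine n) _ rfl (refine_coupling_pos F hγ n) ((hle n hn).trans (min_le_right _ _))
    have hγn1 : γ * ((F.L : ℝ)⁻¹) ^ n ≤ 1 := ((hle n hn).trans (min_le_left _ _)).trans hγ₁1
    refine ⟨K₀, fun K => histGoodInt (F.refine n) (θBal (F.refine n).L (γ * ((F.L : ℝ)⁻¹) ^ n) (bs / c) p₀)
        (θBal (F.refine n).L (γ * ((F.L : ℝ)⁻¹) ^ n) (c * (bs / c)) p₀ 0) K 0, r,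
      fun K => measurableSet_histGoodInt (F.refine n) _ _ K 0, hr, fun K _ => ?_, ht⟩
    refine histGood_subset_histGoodInt (F.refine n)
      (fun i => θBal_mono_profile _ hγn1 hbs.le hbs0 le_rfl i) (Nat.zero_le K) ?_
    rw [hcb]
  exact (continuumYM3Torus_iff_hasContinuumLimit_SU F ℰp measurableE_ℰp hγ.le).mpr hlim

end Leaf

/-! ## §6 (appended) The tree's interior engine AT `m = 0` feeds §5 — and why its `m ≥ 1` members do not

`T3InteriorExcision.unitTilt_interior_of_bg` at `m = 0` (`K / 0 = 0`: comparison lattice = the unit lattice, interior window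
`θBal(c·b₀) 0`) yields for every step `K ≥ 1` EXACTLY the chained interior tilts `ym3TorusSU2_of_interiorTilt` consumes (`K₀ = 1`).
HONEST CAVEAT: at `m ≥ 1` (route `UnitScaleTilt`'s deciding interior item stmt-QuantumFields-20520) the interior constraint sits at
distance `⌊K/m⌋` below the unit lattice; after descent/restriction to the all-heights events
(`AllHeightsSmallTilt.isTilt_unitA_inter_preimage_of_descendedTilt`) the two windows of run `K+1` used by pairs `K` and `K+1` differ
whenever `m ∣ K+1` — NOT a chained family, so the `K`-uniform widening (§2: the uniform mass is spent twice, not every `m` steps)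
does not consume it; only the full-window twins descend without residue (`AllHeightsSmallTilt.unitTiltAt_zero_of_heightSandwichAt`).
-/

section InteriorEngine

open Literature.MathematicalPhysics.QuantumFieldTheory.Balaban1983to89.T3RegularMinimiser (BgStabilityAt)
open Literature.MathematicalPhysics.QuantumFieldTheory.Balaban1983to89.T3PrintedRegularMinimiser
  (MinimiserStabilityRegPrAt)
open Literature.MathematicalPhysics.QuantumFieldTheory.Balaban1983to89.T3InteriorExcision
  (BgFluctuationIntAt FluctuationComparisonRegPrIntAt unitTilt_interior_of_bg θBal_mul_le)

/-- **THE LEAF FROM THE INTERIOR ENGINE AT `m = 0` (ANY BACKGROUNDS) AND r3 AS FILED**: per block size an interior ratio `0 < c ≤ 1`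
and thresholds; for profiles beyond them and `γ ≤ γ₂`, backgrounds `A₀ K, A₁ K` on the unit lattice with `BgStabilityAt F γ b₀ p₀ 0 A₀ A₁`
and `BgFluctuationIntAt F γ b₀ p₀ 0 A₀ A₁ c` (all-heights-restricted unit densities log-comparable a.e. on the `c`-interior of the unit
window, steps `K ≥ 1`) ⇒ with `LargeFieldMassRefinementTail`, `YM3TorusSU2` (`unitTilt_interior_of_bg` at `m = 0`, `γ ≤ 1` for
`θBal_mul_le`, then `ym3TorusSU2_of_interiorTilt` with `K₀ = 1`).  CONDITIONAL; no summit, no mass gap. [cite: King1986, Prop. 3.8-3.9 pp.664-665] -/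
theorem ym3TorusSU2_of_interiorBg_zero
    (hT : ∀ (L : ℕ), ∃ c b₁ p₁ : ℝ, 0 < c ∧ c ≤ 1 ∧ ∀ (b₀ p₀ : ℝ), b₁ ≤ b₀ → p₁ ≤ p₀ → 0 < b₀ → 2 < p₀ →
      ∃ γ₂ : ℝ, 0 < γ₂ ∧ ∀ (F : T3Family) (γ : ℝ), F.L = L → 0 < γ → γ ≤ γ₂ →
        ∃ A₀ A₁ : (K : ℕ) → GaugeField (F.P (K / 0)) 0 (Matrix.specialUnitaryGroup (Fin 2) ℂ) → ℝ,
          BgStabilityAt F γ b₀ p₀ 0 A₀ A₁ ∧ BgFluctuationIntAt F γ b₀ p₀ 0 A₀ A₁ c)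
    (hM : Summit.QuantumFields.YangMills.Theses.SmallFieldWidening.LargeFieldMassRefinementTail) :
    Literature.MathematicalPhysics.QuantumFieldTheory.Balaban1983to89.T3YM3TorusStatement.YM3TorusSU2 := by
  refine ym3TorusSU2_of_interiorTilt (fun L => ?_) hM
  obtain ⟨c, b₁, p₁, hc, hc1, hT₁⟩ := hT L
  refine ⟨c, b₁, p₁, hc, hc1, fun b₀ p₀ hb₁ hp₁ hb₀ hp₀ => ?_⟩
  obtain ⟨γ₂, hγ₂, hT₂⟩ := hT₁ b₀ p₀ hb₁ hp₁ hb₀ hp₀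
  refine ⟨min γ₂ 1, lt_min hγ₂ one_pos, fun F γ hFL hγ hle => ?_⟩
  obtain ⟨A₀, A₁, hst, hfl⟩ := hT₂ F γ hFL hγ (hle.trans (min_le_left _ _))
  have hcθ : ∀ i, θBal F.L γ (c * b₀) p₀ i ≤ θBal F.L γ b₀ p₀ i := fun i =>
    θBal_mul_le F.hL.2.le hγ (hle.trans (min_le_right _ _)) hb₀ hc1 p₀ i
  obtain ⟨r, hr, -, ht⟩ := unitTilt_interior_of_bg hγ.le hcθ hst hfl
  exact ⟨1, r, hr, fun K hK => by simpa only [Nat.div_zero] using ht K hK⟩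

/-- **THE SAME AT PRINT'S REGULAR-MINIMISER BACKGROUNDS** (route `UnitScaleTilt`'s K1aR-pr / K1b-INT bodies READ AT `m = 0`, in the
quantifier shape of stmt-QuantumFields-20520 without its `m ≥ m₀` clause): `MinimiserStabilityRegPrAt F γ b₀ p₀ 0 ε₀` and
`FluctuationComparisonRegPrIntAt F γ b₀ p₀ 0 c ε₀` for profiles beyond thresholds, `0 < ε₀ ≤ ε₁`, `γ ≤ γ₂` ⇒ with
`LargeFieldMassRefinementTail`, `YM3TorusSU2`.  NOT implied by 19200 ∧ 20520 by name (they quantify `m ≥ m₀`; caveat above).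
CONDITIONAL; no summit, no mass gap. [cite: King1986, Prop. 3.8-3.9 pp.664-665] -/
theorem ym3TorusSU2_of_regPrInt_zero
    (hT : ∀ (L : ℕ), ∃ c b₁ p₁ : ℝ, 0 < c ∧ c ≤ 1 ∧ ∀ (b₀ p₀ : ℝ), b₁ ≤ b₀ → p₁ ≤ p₀ → 0 < b₀ → 2 < p₀ →
      ∃ ε₁ : ℝ, 0 < ε₁ ∧ ∀ (ε₀ : ℝ), 0 < ε₀ → ε₀ ≤ ε₁ →
        ∃ γ₂ : ℝ, 0 < γ₂ ∧ ∀ (F : T3Family) (γ : ℝ), F.L = L → 0 < γ → γ ≤ γ₂ →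
          MinimiserStabilityRegPrAt F γ b₀ p₀ 0 ε₀ ∧ FluctuationComparisonRegPrIntAt F γ b₀ p₀ 0 c ε₀)
    (hM : Summit.QuantumFields.YangMills.Theses.SmallFieldWidening.LargeFieldMassRefinementTail) :
    Literature.MathematicalPhysics.QuantumFieldTheory.Balaban1983to89.T3YM3TorusStatement.YM3TorusSU2 := by
  refine ym3TorusSU2_of_interiorBg_zero (fun L => ?_) hM
  obtain ⟨c, b₁, p₁, hc, hc1, hT₁⟩ := hT L
  refine ⟨c, b₁, p₁, hc, hc1, fun b₀ p₀ hb₁ hp₁ hb₀ hp₀ => ?_⟩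
  obtain ⟨ε₁, hε₁, hT₂⟩ := hT₁ b₀ p₀ hb₁ hp₁ hb₀ hp₀
  obtain ⟨γ₂, hγ₂, hT₃⟩ := hT₂ ε₁ hε₁ le_rfl
  exact ⟨γ₂, hγ₂, fun F γ hFL hγ hle => ⟨_, _, hT₃ F γ hFL hγ hle⟩⟩

end InteriorEngine

end Summit.QuantumFields.YangMills.Theorems.WideningOfTiltAndMass

end
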